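/-
Copyright (c) 2026 the pub-hodgecm-mathlib formalisation cell (harness21).  Prover seat hodgecm-mathlib-LH4-p11 (g9), req620 Track A «(D-RAM) FOUR-FRAME» squad, helper lane on
h413 = stmt-HodgeConjecture-24833 (count-neutral).  β-BOARD v1 ROW R6a «THE κ-CLASS OF TOWER 1», FILE D: the slot-`2` indicator of the κ-class character (β chair F0P3a-p01 (g37)
LEDGER #16∕#18 «LH4-p11 per-class head `hκ₁` (owed)», input).  2026-09-04.
-/
import Summits.HodgeConjecture.HodgeConjecture.Theorems.F0P3cDyRamLabelledOddGluedCharacterTwo   -- ★ p861641 (LH4-p17 (g0), R3 FILE 3b): the third-slot carrier; brings ★ p861560 FILE 3 (`S_F` ratios), ★ κG-A2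
import Summits.HodgeConjecture.HodgeConjecture.Theorems.F0P3cDyRamLabelledOddBoundarySums        -- ★ p861608 (LH4-p17 (g0), R3 FILE 4): `normSign_one_add_mul_one_add_eq` (the Möbius identity)
import HarnessLib

/-!
# Crux `H413`, line LH4 «(D-RAM) FOUR-FRAME» — (β-BAL) Stage B, β-BOARD ROW R6a (tower 1), FILE D: THE SLOT-`2` INDICATOR OF THE κ-CLASS CHARACTER

Cell `hodgecm-mathlib` (D-0151), FLOOR 0, crux item H413 = `stmt-HodgeConjecture-24833`, route `HCCMUnconditional`; squad F0∕P3c∕LH4.  THEOREMS ONLY (no `def`, no instance, no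
notation, no `sorry`, default heartbeats); ★-only imports; lane `--supports stmt-HodgeConjecture-24833 --as helper` (count-neutral); pays NO row, states NO law.

WHAT.  The per-orbit value of the κ-class of tower 1 (★ p861844 FILE B `labelledOddCount_div_relIndex_glued_rep_kappaLocus`) on the glued representative `latt V(1,1,g)` is
`ω(g·e_A·(1+r))·ω(D(g)_i)∕2 · [∀ u ∈ S_F, ω(u_i)·μ_c(u) = 1] · w`, `μ_c(u) = ω(u₀)·ω(1 + (u₁∕u₀ − 1)·c)`, `c = r∕(1+r)`, `|c| = |ϖ|^{2k}`.  ★ p861844 §2 gave the indicators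
of slots `0` and `1`; this file gives slot `2`: **`forall_normSign_two_mul_kappaChar_iff` — `[∀ u ∈ S_F(latt V), ω(u₂)·μ_c(u) = 1] ↔ 2d ≤ ρ + 1`** (`c` fixed, `|c| ≤ |ϖ|^k`,
`k ≥ 1`; `|2| < 1` for the killer).  Inside the window `u₂∕u₀, u₁∕u₀ ∈ U^{[ρ]} ⊂ U^{[2d−1]}` (★ p861560 `ratios_of_mem_fixedUnitStabilizer_glued_rep`); below it the third-slot
carrier `u = (1 + e(1+g)∕g, 1, 1 + e)` of ★ p861641 at `e∕(1+e) = w := (n₀ − 1)·g∕(1 − c(1+g))` (`|w| = |n₀ − 1|·|g| ≤ |ϖ|^{2d−2+2t} ≤ |ϖ|^{ρ+2t}`) reads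
`ω(u₂)μ_c(u) = ω(1+e)·ω(1 + λe) = ω(1 + (λ−1)·e∕(1+e)) = ω(n₀) = −1`, `λ = (1−c)(1+g)∕g`, `(λ − 1)w = n₀ − 1` (★ p861608 `normSign_one_add_mul_one_add_eq`; `n₀` the fixed
non-norm one-unit of level `2d−2`, ★ `exists_fixed_unit_not_norm_v_sub_one_le`).  With ★ p861882 (LH4-p08 (g10)) `F0P3cDyRamKappaClassFootSums` (the orbit sums in the
currency `C∕g`) this is the last input of the tower-1 κ-class stratum head (β chair F0P3a-p01 (g37) LEDGER #18 `hκ₁`).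
HONEST LABEL.  Count-neutral (`--supports`); nothing printed is asserted; the per-class head `hκ₁`, hRest, (β) `stub_law_cleanSgn`, T₊ remain OPEN; `HC_CM` is proved only modulo the
7 printed citations (2 remaining named inputs: hLiu418 = `stmt-HodgeConjecture-24832`, h413 = `stmt-HodgeConjecture-24833`) until rung 0 closes.
References: [Kottwitz1986BaseChangeUnits] §1 pp. 240–241 · [Rogawski1990] §4.9 Prop. 4.9.1 (b) p. 55 · [LanglandsShelstad1987] §3 · [Serre1979] Ch. V §3 Prop. 5, Cor. 3, Ch. XV §2.
-/

set_option autoImplicit false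

noncomputable section

namespace Summit.HodgeConjecture.HodgeConjecture.Cruxes.H413.F0P3cDyRamLabelledOddKappaClassSlotTwoG1

open Matrix WithZero
open Literature.NumberTheory.Automorphic Literature.NumberTheory.Automorphic.HermitianLattice Literature.NumberTheory.Automorphic.UnitaryGroup
open Literature.NumberTheory.Automorphic.UnitaryLatticeTree Literature.NumberTheory.Automorphic.UnitaryThreeFourFrame
open Literature.NumberTheory.LocalFields.WildQuadraticDatum
open Summit.HodgeConjecture.HodgeConjecture.Cruxes.H413.F0P3cDyRamDiagonalTorusDefs
open Summit.HodgeConjecture.HodgeConjecture.Cruxes.H413.F0P3cDyRamFixedCountDiagonalModel (normSign_mul_norm)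
open Summit.HodgeConjecture.HodgeConjecture.Cruxes.H413.F0P3cDyRamDiagonalKappaSplitCountEval (normSign_mul_self)
open Summit.HodgeConjecture.HodgeConjecture.Cruxes.H413.F0P3cDyRamLabelledOddGluedCharacter (ratios_of_mem_fixedUnitStabilizer_glued_rep)
open Summit.HodgeConjecture.HodgeConjecture.Cruxes.H413.F0P3cDyRamLabelledOddGluedCharacterTwo (exists_mem_fixedUnitStabilizer_glued_rep_of_ratio₂)
open Summit.HodgeConjecture.HodgeConjecture.Cruxes.H413.F0P3cDyRamLabelledOddBoundarySums (normSign_one_add_mul_one_add_eq)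
open scoped Valued WithZero Matrix MatrixGroups

variable {K : Type} [Field K] [Valued K ℤᵐ⁰] [CompleteSpace K] [Finite 𝓀[K]] {σ : K →+* K} {ϖ : K} {d t₂ : ℕ}

/-- **SLOT `2`: `[∀ u ∈ S_F(latt V(1,1,g)), ω(u₂)·μ_c(u) = 1] ↔ 2d ≤ ρ + 1`**, `μ_c(u) = ω(u₀)·ω(1 + (u₁∕u₀ − 1)·c)`, for `c` fixed with `|c| ≤ |ϖ|^k` (`k, ρ, t ≥ 1`; `|2| < 1` for the
killer).  Inside the window `ω(u₂)ω(u₀) = ω(u₂∕u₀)`, and `u₂∕u₀, u₁∕u₀ ∈ U^{[ρ]} ⊂ U^{[2d−1]}` are norms (★ `ratios_of_mem_fixedUnitStabilizer_glued_rep`); below it the third-slot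
carrier `u = (1 + e(1+g)∕g, 1, 1 + e)` (★ p861641) with `e∕(1+e) = w := (n₀ − 1)·g∕(1 − c(1+g))` (`|w| = |n₀−1||g| ≤ |ϖ|^{2d−2+2t} ≤ |ϖ|^{ρ+2t}`) reads
`ω(u₂)μ_c(u) = ω(1+e)·ω(1 + λe) = ω(1 + (λ−1)w) = ω(n₀) = −1`, `λ = (1−c)(1+g)∕g`, `(λ − 1)w = n₀ − 1`.
[cite: Kottwitz1986BaseChangeUnits, §1 pp. 240–241] [cite: Serre1979, Ch. V §3 Prop. 5, Cor. 3; Ch. XV §2] [cite: LanglandsShelstad1987, §3] -/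
theorem forall_normSign_two_mul_kappaChar_iff (hD : IsRamifiedQuadraticDatum σ ϖ d t₂) (h2 : Valued.v (2 : K) < 1) {ρ t : ℕ} (hρ : 1 ≤ ρ) (ht : 1 ≤ t)
    {g : K} (hσg : σ g = g) (hg : Valued.v g = Valued.v ϖ ^ (2 * t))
    (V : GL (Fin 3) K) (hV : (V : Matrix (Fin 3) (Fin 3) K) = !![1, 0, 0; 1, ϖ ^ ρ, 0; 1 * 1 + g, ϖ ^ ρ * 1, ϖ ^ (2 * ρ + 2 * t)])
    {c : K} (hσc : σ c = c) {k : ℕ} (hk : 1 ≤ k) (hck : Valued.v c ≤ Valued.v ϖ ^ k) :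
    (∀ u ∈ fixedUnitStabilizer σ (latt (V : Matrix (Fin 3) (Fin 3) K)),
        normSign σ ((u 2 : Kˣ) : K) * (normSign σ ((u 0 : Kˣ) : K) * normSign σ (1 + (((u 1 : Kˣ) : K) / ((u 0 : Kˣ) : K) - 1) * c)) = 1) ↔
      2 * d ≤ ρ + 1 := by
  obtain ⟨hσ, hvσ, hϖ, -, -, -, -⟩ := id hD
  have hϖ0 : ϖ ≠ 0 := (Valuation.ne_zero_iff Valued.v).1 (by rw [hϖ]; exact exp_ne_zero)
  have hvϖ : 0 < Valued.v ϖ := (Valuation.pos_iff _).2 hϖ0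
  have hϖ1 : Valued.v ϖ < 1 := by rw [hϖ, ← exp_zero, exp_lt_exp]; norm_num
  have hmono : ∀ {a b : ℕ}, a ≤ b → Valued.v ϖ ^ b ≤ Valued.v ϖ ^ a := fun h => pow_le_pow_right_of_le_one' hϖ1.le h
  have hplt : ∀ {n : ℕ}, 1 ≤ n → Valued.v ϖ ^ n < 1 := fun hn => pow_lt_one₀ zero_le hϖ1 (by omega)
  have hc1 : Valued.v c < 1 := hck.trans_lt (hplt hk)
  have hg0 : g ≠ 0 := fun h => by rw [h, map_zero] at hg; exact (pow_ne_zero _ hvϖ.ne') hg.symm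
  have hglt : Valued.v g < 1 := by rw [hg]; exact hplt (by omega)
  have h1g : Valued.v (1 + g) = 1 := Valued.v.map_one_add_of_lt hglt
  have h1g0 : (1 : K) + g ≠ 0 := fun h => by rw [h, map_zero] at h1g; exact zero_ne_one h1g
  -- `ω(a)·ω(b) = ω(a∕b)` on fixed non-zero elements
  have hquot : ∀ a b : K, σ a = a → σ b = b → a ≠ 0 → b ≠ 0 → normSign σ a * normSign σ b = normSign σ (a / b) := by
    intro a b hσa hσb ha0 hb0
    rw [← normSign_mul_of_fixed hD hσa hσb ha0 hb0, show a * b = a / b * (b * σ b) by rw [hσb]; field_simp, normSign_mul_norm σ _ hb0]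
  constructor
  · -- a killer below the window
    intro hall
    by_contra hlt
    push Not at hlt
    obtain ⟨n₀, hσn₀, hn₀1, hn₀d, hn₀n⟩ := exists_fixed_unit_not_norm_v_sub_one_le hD h2
    have hn₀d' : Valued.v (n₀ - 1) ≤ Valued.v ϖ ^ (2 * (d - 1)) := by
      rw [v_varpi_pow hϖ]; convert hn₀d using 2; push_cast; ring
    have hn₀0 : n₀ ≠ 0 := fun h0 => by rw [h0, map_zero] at hn₀1; exact zero_ne_one hn₀1
    -- the denominator `1 − c(1+g)` is a fixed one-unit
    have hcg : Valued.v (c * (1 + g)) < 1 := by rw [map_mul, h1g, mul_one]; exact hc1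
    have hden1 : Valued.v (1 - c * (1 + g)) = 1 := by
      rw [sub_eq_add_neg]; exact Valued.v.map_one_add_of_lt (by rw [Valuation.map_neg]; exact hcg)
    have hden0 : (1 : K) - c * (1 + g) ≠ 0 := fun h0 => by rw [h0, map_zero] at hden1; exact zero_ne_one hden1
    have hσden : σ (1 - c * (1 + g)) = 1 - c * (1 + g) := by rw [map_sub, map_one, map_mul, hσc, map_add, map_one, hσg]
    -- `w = (n₀ − 1)g∕(1 − c(1+g))`, `e = w∕(1 − w)`
    set w : K := (n₀ - 1) * g / (1 - c * (1 + g)) with hwdef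
    have hσw : σ w = w := by rw [hwdef, map_div₀, map_mul, map_sub, map_one, hσn₀, hσg, hσden]
    have hvw : Valued.v w ≤ Valued.v ϖ ^ (ρ + 2 * t) := by
      rw [hwdef, map_div₀, hden1, div_one, map_mul, hg, pow_add]
      exact mul_le_mul_left (hn₀d'.trans (hmono (by omega))) _
    have hwlt : Valued.v w < 1 := hvw.trans_lt (hplt (by omega))
    have h1w : Valued.v (1 - w) = 1 := by rw [sub_eq_add_neg]; exact Valued.v.map_one_add_of_lt (by rw [Valuation.map_neg]; exact hwlt)
    have h1w0 : (1 : K) - w ≠ 0 := fun h0 => by rw [h0, map_zero] at h1w; exact zero_ne_one h1w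
    set e : K := w / (1 - w) with hedef
    have hσe : σ e = e := by rw [hedef, map_div₀, map_sub, map_one, hσw]
    have hve : Valued.v e ≤ Valued.v ϖ ^ (ρ + 2 * t) := by rw [hedef, map_div₀, h1w, div_one]; exact hvw
    have helt : Valued.v e < 1 := hve.trans_lt (hplt (by omega))
    have h1e : Valued.v (1 + e) = 1 := Valued.v.map_one_add_of_lt helt
    have h1e0 : (1 : K) + e ≠ 0 := fun h0 => by rw [h0, map_zero] at h1e; exact zero_ne_one h1e
    obtain ⟨u, hu, hu0, hu1, hu2⟩ := exists_mem_fixedUnitStabilizer_glued_rep_of_ratio₂ hϖ0 hϖ1 hρ ht hσg hg V hV hσe hve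
    -- the first coordinate `1 + X`, `X = e(1+g)∕g`, `|X| ≤ |ϖ|^ρ`
    set X : K := e * (1 + g) / g with hXdef
    have hσX : σ X = X := by rw [hXdef, map_div₀, map_mul, hσe, map_add, map_one, hσg]
    have hvX : Valued.v X ≤ Valued.v ϖ ^ ρ := by
      rw [hXdef, map_div₀, map_mul, h1g, mul_one, hg, div_le_iff₀ (zero_lt_iff.2 (pow_ne_zero _ hvϖ.ne')), ← pow_add]
      exact hve
    have hXlt : Valued.v X < 1 := hvX.trans_lt (hplt hρ)
    have h1X : Valued.v (1 + X) = 1 := Valued.v.map_one_add_of_lt hXlt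
    have h1X0 : (1 : K) + X ≠ 0 := fun h0 => by rw [h0, map_zero] at h1X; exact zero_ne_one h1X
    have hσ1X : σ (1 + X) = 1 + X := by rw [map_add, map_one, hσX]
    -- `λ = (1−c)(1+g)∕g`, `(1 − c)X = λe`, `|λ e| < 1`
    set lam : K := (1 - c) * (1 + g) / g with hlamdef
    have hσlam : σ lam = lam := by rw [hlamdef, map_div₀, map_mul, map_sub, map_one, hσc, map_add, map_one, hσg]
    have hlamX : (1 - c) * X = lam * e := by rw [hXdef, hlamdef]; field_simp
    have hc1' : Valued.v (1 - c) ≤ 1 := by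
      rw [sub_eq_add_neg]; exact (Valuation.map_add _ _ _).trans (max_le (le_of_eq (map_one _)) (by rw [Valuation.map_neg]; exact hc1.le))
    have hlame : Valued.v (lam * e) < 1 := by
      rw [← hlamX, map_mul]
      calc Valued.v (1 - c) * Valued.v X ≤ 1 * Valued.v X := mul_le_mul_left hc1' _
        _ < 1 := by rw [one_mul]; exact hXlt
    have h1lame : Valued.v (1 + lam * e) = 1 := Valued.v.map_one_add_of_lt hlame
    have h1lame0 : (1 : K) + lam * e ≠ 0 := fun h0 => by rw [h0, map_zero] at h1lame; exact zero_ne_one h1lame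
    have hσ1lame : σ (1 + lam * e) = 1 + lam * e := by rw [map_add, map_one, map_mul, hσlam, hσe]
    have hσ1e : σ (1 + e) = 1 + e := by rw [map_add, map_one, hσe]
    -- evaluate the character on the carrier
    have h := hall u hu
    have hA : normSign σ ((u 0 : Kˣ) : K) * normSign σ (1 + (((u 1 : Kˣ) : K) / ((u 0 : Kˣ) : K) - 1) * c) = normSign σ (1 + lam * e) := by
      rw [hu0, hu1, show (1 : K) + (1 / (1 + X) - 1) * c = (1 + lam * e) / (1 + X) by rw [← hlamX]; field_simp; ring,
        ← hquot _ _ hσ1lame hσ1X h1lame0 h1X0, ← mul_assoc, mul_right_comm, normSign_mul_self, one_mul]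
    have hB : normSign σ ((u 2 : Kˣ) : K) * normSign σ (1 + lam * e) = normSign σ (1 + (lam - 1) * (e / (1 + e))) := by
      rw [hu2, ← normSign_mul_of_fixed hD hσ1e hσ1lame h1e0 h1lame0, normSign_one_add_mul_one_add_eq σ hσe helt]
    have hC : (lam - 1) * (e / (1 + e)) = n₀ - 1 := by
      have hew : e / (1 + e) = w := by rw [hedef]; field_simp; ring
      rw [hew, hlamdef, hwdef]; field_simp; ring
    rw [hA, hB, hC, add_sub_cancel, normSign_of_not_isNorm σ hn₀n] at h
    norm_num at h
  · -- inside the window every factor is `1`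
    intro hwin u hu
    obtain ⟨-, huv, huσ⟩ := (mem_fixedUnitStabilizer_iff σ _ u).1 hu
    have h0 : ∀ j, ((u j : Kˣ) : K) ≠ 0 := fun j => (u j).ne_zero
    obtain ⟨hx, hy, -⟩ := ratios_of_mem_fixedUnitStabilizer_glued_rep (σ := σ) hϖ0 hϖ1 ht hg V hV hu
    -- `|u₀ − u₁| ≤ |ϖ|^ρ`, `|u₂ − u₁| ≤ |ϖ|^ρ`, hence `u₂∕u₀, u₁∕u₀ ∈ U^{[ρ]}`
    have hx' : Valued.v (((u 0 : Kˣ) : K) - ((u 1 : Kˣ) : K)) ≤ Valued.v ϖ ^ ρ := by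
      rw [div_sub_one (h0 1), map_div₀, huv 1, div_one] at hx; exact hx
    have hy' : Valued.v (((u 2 : Kˣ) : K) - ((u 1 : Kˣ) : K)) ≤ Valued.v ϖ ^ ρ := by
      rw [div_sub_one (h0 1), map_div₀, huv 1, div_one] at hy; exact hy.trans (hmono (by omega))
    have h20 : Valued.v (((u 2 : Kˣ) : K) / ((u 0 : Kˣ) : K) - 1) ≤ Valued.v ϖ ^ ρ := by
      rw [div_sub_one (h0 0), map_div₀, huv 0, div_one,
        show ((u 2 : Kˣ) : K) - ((u 0 : Kˣ) : K) = (((u 2 : Kˣ) : K) - ((u 1 : Kˣ) : K)) + (((u 1 : Kˣ) : K) - ((u 0 : Kˣ) : K)) by ring]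
      exact (Valuation.map_add _ _ _).trans (max_le hy' (by rw [Valuation.map_sub_swap]; exact hx'))
    have h10 : Valued.v (((u 1 : Kˣ) : K) / ((u 0 : Kˣ) : K) - 1) ≤ Valued.v ϖ ^ ρ := by
      rw [div_sub_one (h0 0), map_div₀, huv 0, div_one, Valuation.map_sub_swap]; exact hx'
    have hσq : ∀ i j : Fin 3, σ (((u i : Kˣ) : K) / ((u j : Kˣ) : K)) = ((u i : Kˣ) : K) / ((u j : Kˣ) : K) := fun i j => by rw [map_div₀, huσ, huσ]
    have hω1 : normSign σ (1 + (((u 1 : Kˣ) : K) / ((u 0 : Kˣ) : K) - 1) * c) = 1 :=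
      normSign_eq_one_of_fixed_of_v_sub_one_le hD (by rw [map_add, map_one, map_mul, map_sub, map_one, hσq, hσc]) (n := ρ) (by omega)
        (by rw [add_sub_cancel_left, map_mul]
            calc Valued.v (((u 1 : Kˣ) : K) / ((u 0 : Kˣ) : K) - 1) * Valued.v c ≤ Valued.v ϖ ^ ρ * 1 := mul_le_mul' h10 hc1.le
              _ = Valued.v ϖ ^ ρ := mul_one _)
    rw [hω1, mul_one, hquot _ _ (huσ 2) (huσ 0) (h0 2) (h0 0)]
    exact normSign_eq_one_of_fixed_of_v_sub_one_le hD (hσq 2 0) (n := ρ) (by omega) h20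

end Summit.HodgeConjecture.HodgeConjecture.Cruxes.H413.F0P3cDyRamLabelledOddKappaClassSlotTwoG1

end
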